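import Summits.HodgeConjecture.HodgeConjecture.Theorems.F0P3CohClassRoutingCot          -- ★ `CohClassRoutingCotClosed` (the GUARDED string, closed over the letters' frames), ★ `RoutesAt`, ★ `IsCot`, `HasToken`, `Gp`
import Summits.HodgeConjecture.HodgeConjecture.Theorems.F0P3Rung0HaarPackage            -- ★ `exists_isHaarMeasure_gqs_quotient_center` (a Haar measure on `U(Φ₃)(L⁺_v) ⧸ Z`)
import Summits.HodgeConjecture.HodgeConjecture.Theorems.F0P3XiPacketFamilyOfRecord      -- ★ `exists_keysData_of_keysCaseTwo` (Keys' labelled pair `(π², πⁿ)` from ★ NF1 `KeysCaseTwo`)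
import Literature.NumberTheory.Rogawski1990.SemilocalQuadraticCharExtension             -- ★ `isQuadraticCharExtension_semilocalComponent_of_baseChange_eq` («`μ|_{F_v^×} = ω_{E_v/F_v}`»)
import Literature.NumberTheory.Rogawski1990.GlobalAPacketLetters                        -- ★ `MemXiFamily` and the S2♭ frame (the organ's token text)
import HarnessLib

/-!
# R90-TF · S5 «Ch. 13.3» · ORGAN FIN (`F0P3cS2SharpPaydown.S2FinLetter`, LH1 leaf :114) FROM THE GUARDED STRING ★ `CohClassRoutingCotClosed` + A-PACKET RIGIDITY
# (Rogawski 1990, §15.3 ¶1 p. 249 on the COTANGENT locus: [(14.6.2) p. 241 + Thm. 13.3.6 (c) p. 202 + §14.4] ∘ [Thm. 14.6.4 p. 243])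

Cell `hodgecm-mathlib`, programme R90-TF, section S5 (base `R90-C133`), prover seat R90-C133-p02 (g0); sibling of `Theorems/R90S5XiMembershipOfArchJOfString.lean`
(p861428: the spine socket S5#2 `R90.S5.XiMembershipOfArchJLetter` from (U-K) NF1 `KeysCaseTwo` + (U-S) the UNGUARDED string ★ `CohClassRouting` + (U-R) A-packet
rigidity).  Crux item `stmt-HodgeConjecture-24833` (h413); `--supports` helper, closes nothing by itself.  PROOF LANE: theorems only (no `def`, no instance declaration,
no notation, no `sorry`); ★ `Theorems`∕`Literature` imports only, so the organ FIN (`Cruxes/H413/Lines/F0_P3c_S2SharpPaydown.lean` :114 `S2FinLetter`, consumer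
`stub_S2fin` :348, R90 junction S5#3 `R90_S5_GlobalPacketFinB.s2Fin_of_spine`) is concluded BY NAME-SHAPE (its body token for token, as in ★
`F0P3cCohClassRoutingCotOfS2Fin`'s hypothesis `hFin`).

WHAT THIS FILE RECORDS (a DAG fact for the architect, kernel-checked): FIN is the spine socket (G∞) ON THE COTANGENT LOCUS (file B's `s2Fin_of_spine`), and on that locus the
string is the GUARDED letter — the ★ closed text `F0P3CohClassRoutingCot.CohClassRoutingCotClosed`, which is ALSO the statement of the rung-0 closer's registered
`stub_L3` (`Cruxes/H413/Lines/F0_U3LettersRung1.lean`, there DERIVED from S2♯ via ★ `cohClassRoutingCotClosed_of_s2sharp`).  Hence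
`s2Fin_of_routingCotClosed_of_aPacketRigidity : (∀ L, KeysCaseTwo L) → CohClassRoutingCotClosed → ‹A-packet rigidity (U-R)› → ‹S2FinLetter body›` — FIN ⟸ NF1 + the
guarded string BY NAME + (U-R); conversely ★ `F0P3cCohClassRoutingCotOfS2Fin.cohClassRoutingCotClosed_of_s2Fin` gives the guarded string from FIN, so over ★ ∪ {NF1, (U-R)}
the organ FIN and the guarded string are EQUIVALENT.  (U-R) as in the sibling file: a discrete `P` that ROUTES to `ξ` off a finite `S₁` (★ `RoutesAt`) lies in the
ξ-envelope ★ `MemXiFamily` at every finite place [Thm. 14.6.4 ∘ 13.3.5]; payer S9∕S7.  HONEST LABEL: HC_CM is proved only modulo the 7 printed citations (2 remaining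
named inputs: hLiu418 = stmt-HodgeConjecture-24832, h413 = stmt-HodgeConjecture-24833) until rung 0 closes; REL ≠ ★ ≠ BUILT.

References: [Rogawski1990] J. Rogawski, *Automorphic Representations of Unitary Groups in Three Variables*, Ann. of Math. Stud. 123 (1990): §15.3 ¶1 p. 249; §14.6
(14.6.2) p. 241, Thm. 14.6.4 p. 243; §13.3 Thm. 13.3.5, 13.3.6 (c) p. 202; §12.2 (2) pp. 173–174; §4.8 p. 51.  [BorelWallach2000] A. Borel, N. Wallach, 2nd ed. (2000),
VI Thm. 4.11.  [Keys1984] D. Keys, Compositio Math. 51 (1984).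
-/

-- Mathlib idiom (as in ★ `F0P3CohClassRoutingCot`, ★ `GlobalAPacketLetters`): the commutator bracket on `Module.End ℂ M`, needed to MENTION
-- `(uFormGroup (Fin 2) (Fin 1)).lie →ₗ⁅ℝ⁆ Module.End ℂ M` in the organ's text.
attribute [local instance 100] LieRing.ofAssociativeRing

set_option autoImplicit false
-- the mandated namespace repeats the single-problem summit's segment (`HodgeConjecture.HodgeConjecture`)
set_option linter.dupNamespace false

noncomputable section

open NumberField IsDedekindDomain MeasureTheory
open scoped Matrix ComplexOrder

namespace Summit.HodgeConjecture.HodgeConjecture.R90.S5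

open Literature.NumberTheory.Automorphic Literature.NumberTheory.Automorphic.UnitaryGroup
open Literature.NumberTheory.Automorphic.UnitaryGroup.CotangentForms
open Literature.NumberTheory.GaloisRepresentations
open Literature.NumberTheory.Rogawski1990
open Literature.RepresentationTheory Literature.RepresentationTheory.BorelWallach2000
open Literature.RepresentationTheory.KonnoKonno2007
open Summit.HodgeConjecture.HodgeConjecture.Cruxes.H413
open Summit.HodgeConjecture.HodgeConjecture.Cruxes.H413.F0P3InnerFormClassificationV6 (Gp HasToken IsCot)
open Summit.HodgeConjecture.HodgeConjecture.Cruxes.H413.F0P3CohClassRoutingCot (RoutesAt CohClassRoutingCot CohClassRoutingCotClosed)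
open Summit.HodgeConjecture.HodgeConjecture.Cruxes.H413.F0P3Rung0HaarPackage (exists_isHaarMeasure_gqs_quotient_center)
open Summit.HodgeConjecture.HodgeConjecture.Cruxes.H413.F0P3XiPacketFamilyOfRecord (exists_keysData_of_keysCaseTwo)

/-- **ORGAN FIN FROM NF1 + THE GUARDED STRING ★ `CohClassRoutingCotClosed` + A-PACKET RIGIDITY.**  Conclusion = the body of the LH1 leaf's `S2FinLetter`
token for token (for every discrete `P` of holomorphic-or-antiholomorphic cotangent type at the CM frame, `K_c`-trivial, with a `(𝔤,K)`-token at `ι` into an irreducible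
module carrying a degree-one class of type `δ = ±1`: `∃ ξ, MemXiFamily P … μω hμu ξ`).  Proof: in the given frame read Borel σ-algebras, Haar measures `μZ v` on
`U(Φ₃)(L⁺_v) ⧸ Z` (★ `exists_isHaarMeasure_gqs_quotient_center`) and Keys' data (★ `exists_keysData_of_keysCaseTwo` at ★
`isQuadraticCharExtension_semilocalComponent_of_baseChange_eq`); the cotangent hypothesis IS ★ `IsCot` and the token text IS ★ `HasToken` (δ), so the guarded string gives
`ξ`, `S₁` with ★ `RoutesAt … P ξ v` off `S₁`, and rigidity (U-R) upgrades it to `MemXiFamily P … ξ`; the `K_c`-triviality hypothesis is idle (kept: the organ's bytes are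
frozen).  PRINT: §15.3 ¶1 on the cotangent locus = [(14.6.2) + 13.3.6 (c) + §14.4] ∘ [Thm. 14.6.4].
[cite: Rogawski1990, §15.3 ¶1 (p. 249); §14.6 (14.6.2) p. 241, Thm. 14.6.4 (p. 243); Thm. 13.3.5, Thm. 13.3.6 (c) (p. 202); §12.2 (2) pp. 173–174; §4.8 p. 51]
[cite: BorelWallach2000, VI Thm. 4.11] [cite: Keys1984] -/
theorem s2Fin_of_routingCotClosed_of_aPacketRigidity
    (hKeys : ∀ (L : Type) [Field L] [NumberField L] [IsCMField L], KeysCaseTwo L)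
    (hL3 : CohClassRoutingCotClosed)
    (hRigid : ∀ (L : Type) [Field L] [NumberField L] [IsCMField L] (H : Matrix (Fin 3) (Fin 3) L)
      (hH : (H.map (cmConjRingHom L))ᵀ = H) (hHd : IsUnit H.det) (μω : HeckeCharacter L) (hμu : μω.IsUnitary),
      (∀ x : Literature.NumberTheory.GaloisRepresentations.ideleGroup ↥(maximalRealSubfield L), μω (AdeleRing.ideleBaseChange (↥(maximalRealSubfield L)) L x) = quadraticHeckeCharCM L x) →
      ∀ [∀ v : HeightOneSpectrum (𝓞 ↥(maximalRealSubfield L)), MeasurableSpace (Gqs L v ⧸ Subgroup.center (Gqs L v))]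
        [∀ v : HeightOneSpectrum (𝓞 ↥(maximalRealSubfield L)), BorelSpace (Gqs L v ⧸ Subgroup.center (Gqs L v))]
        (μZ : ∀ v : HeightOneSpectrum (𝓞 ↥(maximalRealSubfield L)), Measure (Gqs L v ⧸ Subgroup.center (Gqs L v)))
        [∀ v : HeightOneSpectrum (𝓞 ↥(maximalRealSubfield L)), (μZ v).IsHaarMeasure]
        (keys : ∀ (ξ : OneDimAutRepH L) (v : HeightOneSpectrum (𝓞 ↥(maximalRealSubfield L))),
          (∀ w : PlacesOver L v, IsCMField.complexConj L • w.1 = w.1) →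
            {p : IrrClass (Gqs L v) × IrrClass (Gqs L v) //
              KeysCaseTwoLabels L v (μω.semilocalComponent L v) (torusLocalComponent L (IsCMField.complexConj L) v ξ.η)
                (torusLocalComponent L (IsCMField.complexConj L) v ξ.ψ) p.1 p.2 ∧
              p.1.IsSquareIntegrable (μZ v) ∧ ¬ p.2.IsSquareIntegrable (μZ v)})
        (μ : Measure (Gp L H).automorphicQuotient) [(Gp L H).IsAutomorphicMeasure μ]
        (P : DiscreteAutomorphicRep (Gp L H) μ) (ξ : OneDimAutRepH L) (S₁ : Finset (HeightOneSpectrum (𝓞 ↥(maximalRealSubfield L)))),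
      (∀ v : HeightOneSpectrum (𝓞 ↥(maximalRealSubfield L)), v ∉ S₁ → RoutesAt L H hH hHd μω hμu μZ keys μ P ξ v) →
      MemXiFamily P hH hHd μω hμu ξ) :
    ∀ (L : Type) [Field L] [NumberField L] [IsCMField L] (ι : L →+* ℂ) (H : Matrix (Fin 3) (Fin 3) L) (T : GL (Fin 3) ℂ)
      (hT : (T : Matrix (Fin 3) (Fin 3) ℂ)ᴴ * H.map ι * (T : Matrix (Fin 3) (Fin 3) ℂ) = Literature.Geometry.ComplexHyperbolic.BallModel.J),
      (∀ τ' : L →+* ℂ, InfinitePlace.mk τ' ≠ InfinitePlace.mk ι → (H.map τ').PosDef) →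
      2 ≤ Module.finrank ℚ ↥(maximalRealSubfield L) →
      ∀ (μ : Measure (adelicGroupData (↥(maximalRealSubfield L)) L (IsCMField.complexConj L) 3 H).automorphicQuotient)
        [(adelicGroupData (↥(maximalRealSubfield L)) L (IsCMField.complexConj L) 3 H).IsAutomorphicMeasure μ]
        (μω : HeckeCharacter L) (hμu : μω.IsUnitary),
        (∀ x : Literature.NumberTheory.GaloisRepresentations.ideleGroup ↥(maximalRealSubfield L),
          μω (AdeleRing.ideleBaseChange (↥(maximalRealSubfield L)) L x) = quadraticHeckeCharCM L x) →
      ∀ (P : DiscreteAutomorphicRep (adelicGroupData (↥(maximalRealSubfield L)) L (IsCMField.complexConj L) 3 H) μ),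
        (P.IsHolCotangentAt (cmArchSection L ι H T hT) (cmCompactFactor L ι H T hT) ∨
          P.IsAntiholCotangentAt (cmArchSection L ι H T hT) (cmCompactFactor L ι H T hT)) →
        (∀ k : (adelicGroupData (↥(maximalRealSubfield L)) L (IsCMField.complexConj L) 3 H).Adelic, k ∈ cmCompactFactor L ι H T hT →
          ∀ v : P.space.toSubmodule, (adelicGroupData (↥(maximalRealSubfield L)) L (IsCMField.complexConj L) 3 H).rightRegular μ k
            (v : (adelicGroupData (↥(maximalRealSubfield L)) L (IsCMField.complexConj L) 3 H).L2 μ) = v) →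
        ∀ (M : Type) [AddCommGroup M] [Module ℂ M]
          (σK : Representation ℂ (uFormGroup (Fin 2) (Fin 1)).maximalCompact M) (σ𝔤 : (uFormGroup (Fin 2) (Fin 1)).lie →ₗ⁅ℝ⁆ Module.End ℂ M)
          (hM : IsGKModule (uFormGroup (Fin 2) (Fin 1)) σK σ𝔤), IsIrreducibleGK σK σ𝔤 →
          (∃ T₁ : P.archModuleCM ι T hT →ₗ[ℂ] M,
            (∀ (k : (uFormGroup (Fin 2) (Fin 1)).maximalCompact) (w : P.archModuleCM ι T hT), T₁ (P.archRepKCM ι T hT k w) = σK k (T₁ w)) ∧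
              (∀ (X : (uFormGroup (Fin 2) (Fin 1)).lie) (w : P.archModuleCM ι T hT), T₁ (P.archRepLieCM ι T hT X w) = σ𝔤 X (T₁ w)) ∧ T₁ ≠ 0) →
          ∀ δ : ℤ, (δ = 1 ∨ δ = -1) → upqTypeClasses σK σ𝔤 hM.ad_compat 1 δ ≠ ⊥ →
            ∃ ξ : OneDimAutRepH L,
              MemXiFamily P (transpose_map_cmConjRingHom_eq_of_frame L ι H T hT) (isUnit_det_of_frame L ι H T hT) μω hμu ξ := by
  intro L _ _ _ ι H T hT hdef h2 μ _ μω hμu hμω P hP _hKc M _ _ σK σ𝔤 hM hirr htok δ hδ hne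
  -- the frame data the string is read in: Borel σ-algebras and Haar measures on `U(Φ₃)(L⁺_v) ⧸ Z`, Keys' data from NF1
  letI : ∀ v : HeightOneSpectrum (𝓞 ↥(maximalRealSubfield L)), MeasurableSpace (Gqs L v ⧸ Subgroup.center (Gqs L v)) := fun _ => borel _
  haveI : ∀ v : HeightOneSpectrum (𝓞 ↥(maximalRealSubfield L)), BorelSpace (Gqs L v ⧸ Subgroup.center (Gqs L v)) := fun _ => ⟨rfl⟩
  have hZ : ∀ v : HeightOneSpectrum (𝓞 ↥(maximalRealSubfield L)),
      ∃ μv : Measure (Gqs L v ⧸ Subgroup.center (Gqs L v)), μv.IsHaarMeasure :=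
    fun v => exists_isHaarMeasure_gqs_quotient_center L v
  let μZ : ∀ v : HeightOneSpectrum (𝓞 ↥(maximalRealSubfield L)), Measure (Gqs L v ⧸ Subgroup.center (Gqs L v)) := fun v => (hZ v).choose
  haveI : ∀ v : HeightOneSpectrum (𝓞 ↥(maximalRealSubfield L)), (μZ v).IsHaarMeasure := fun v => (hZ v).choose_spec
  have hquad : ∀ v : HeightOneSpectrum (𝓞 ↥(maximalRealSubfield L)), (∀ w : PlacesOver L v, IsCMField.complexConj L • w.1 = w.1) →
      IsQuadraticCharExtension (conjLocal L (IsCMField.complexConj L) v) (μω.semilocalComponent L v) :=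
    fun v _ => isQuadraticCharExtension_semilocalComponent_of_baseChange_eq μω hμω v
  let keys : ∀ (ξ : OneDimAutRepH L) (v : HeightOneSpectrum (𝓞 ↥(maximalRealSubfield L))),
      (∀ w : PlacesOver L v, IsCMField.complexConj L • w.1 = w.1) →
        {p : IrrClass (Gqs L v) × IrrClass (Gqs L v) //
          KeysCaseTwoLabels L v (μω.semilocalComponent L v) (torusLocalComponent L (IsCMField.complexConj L) v ξ.η)
            (torusLocalComponent L (IsCMField.complexConj L) v ξ.ψ) p.1 p.2 ∧
          p.1.IsSquareIntegrable (μZ v) ∧ ¬ p.2.IsSquareIntegrable (μZ v)} :=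
    fun ξ v hns => Classical.choice (exists_keysData_of_keysCaseTwo L μω (hKeys L) μZ hquad ξ v hns)
  -- the cotangent guard and the token text are ★ `IsCot` ∕ ★ `HasToken` (δ)
  have hcot : IsCot L H ι T hT μ P := hP
  have htok' : HasToken L H ι T hT μ P M σK σ𝔤 := htok
  -- the guarded string: `ξ` and `S₁` with `RoutesAt … P ξ v` off `S₁`
  have hroute : CohClassRoutingCot L H (transpose_map_cmConjRingHom_eq_of_frame L ι H T hT) (isUnit_det_of_frame L ι H T hT) μω hμu
      μZ keys ι T hT μ :=
    hL3 L ι H T hT (transpose_map_cmConjRingHom_eq_of_frame L ι H T hT) (isUnit_det_of_frame L ι H T hT) hdef h2 μ μω hμu hμω μZ keys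
  obtain ⟨ξ, S₁, hS⟩ := hroute P hcot M σK σ𝔤 hM hirr htok' δ hδ hne
  -- rigidity upgrades the string to membership at every finite place
  exact ⟨ξ, hRigid L H (transpose_map_cmConjRingHom_eq_of_frame L ι H T hT) (isUnit_det_of_frame L ι H T hT) μω hμu hμω μZ keys μ
    P ξ S₁ (fun v hv => hS v hv)⟩

end Summit.HodgeConjecture.HodgeConjecture.R90.S5

end
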